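import Literature.Analysis.FluidPDE.MikadoSelfInteraction
import HarnessLib

/-!
# Divergence identities for integration by parts against oscillatory factors on the flat 3-torus

Analysis/FluidPDE support file (definitions with proved API; no named facts) on the discharge path of the
principal-parts hypothesis `hA` of
`Literature.Barriers.NavierStokesRegularity.CriticalDataSmoothNonuniqueness_of_principalParts`
(M. P. Coiculescu, S. Palasek, Invent. Math. 244 (2025), arXiv:2503.14699), Prop. 4.1, the oscillation term
`ℛ div 𝒩_{k,2}`. The gain of the antidivergence on `(slow amplitude) × (oscillatory factor)` is realised by
EXPLICIT symmetric tensors (the classical integration-by-parts expansion behind the stationary phase lemma,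
Daneri–Székelyhidi 2017 Lemma 2.2 / BDSV Prop. C.2, written as algebra): for smooth scalars `σ`, `q`, `Y`, `f` and
constant vectors `c`, `d`,

* `CP25.tensorDiv_mul_const_apply` — `div(f K)_a = ∑_b K_{ab} ∂_b f` for a constant matrix `K`; whence
  `tensorDiv_mul_dyad_apply` (`div(f c⊗c) = c (c·∇f)`) and `tensorDiv_mul_symDyad_apply`
  (`div(Y(c⊗d + d⊗c)) = c(d·∇Y) + d(c·∇Y)`);
* `CP25.ibpTensor σ q c = σ(c⊗∇q + ∇q⊗c - (c·∇q)Id)` (symmetric) and **`tensorDiv_ibpTensor_apply`**: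
  `div(ibpTensor)_a = c_a(σΔq + ∇σ·∇q) + ∂_a q (c·∇σ) - ∂_a σ (c·∇q)`, so that
  `c σ Δq = div(ibpTensor σ q c) - [c(∇σ·∇q) + ∇q(c·∇σ) - ∇σ(c·∇q)]` — one integration by parts gains
  `‖∇q‖/‖Δq‖ ∼ λ⁻¹` on an amplitude of frequency `≪ λ`.

## Mathlib / tree search

Tree: `CP25.tensorDiv`, `tensorDiv_apply` (`LerayTensorHolder`), `isSmooth_of_entries` (`MikadoSelfInteraction`),
`Torus.partialDeriv_mul/add/sub/const_mul/mul_const/finset_sum/comm`, `laplacian_eq_sum_partialDeriv_partialDeriv`.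

## References

* M. P. Coiculescu, S. Palasek, Invent. Math. 244 (2025) 165–219, arXiv:2503.14699: Prop. 4.1 (`F₄,₄`), Lemma 6.4.
  [CoiculescuPalasek2025]
* S. Daneri, L. Székelyhidi Jr., Arch. Ration. Mech. Anal. 224 (2017), Lemma 2.2. [DaneriSzekelyhidi2017]
-/

noncomputable section

open MeasureTheory Set Filter Function
open _root_.Topology
open scoped BigOperators ContDiff

namespace Literature.Analysis.FluidPDE

namespace CP25

open Literature.Analysis.FunctionSpaces Literature.Analysis.FunctionSpaces.Torus

variable {f σ q Y : UnitAddTorus (Fin 3) → ℝ}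

/-! ## Constant matrices -/

/-- A smooth scalar times a constant matrix is a smooth tensor. [folklore] -/
theorem isSmooth_mul_const_tensor (hf : IsSmooth f) (K : Fin 3 → Fin 3 → ℝ) : IsSmooth fun y i j => f y * K i j :=
  isSmooth_of_entries fun _ _ => hf.mul contDiff_const

/-- **`div(f K)_a = ∑_b K_{ab} ∂_b f`** for a constant matrix `K`. [folklore] -/
theorem tensorDiv_mul_const_apply (f : UnitAddTorus (Fin 3) → ℝ) (K : Fin 3 → Fin 3 → ℝ) (x : UnitAddTorus (Fin 3)) (a : Fin 3) :
    tensorDiv (fun y a b => f y * K a b) x a = ∑ b, K a b * Torus.partialDeriv b f x := by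
  rw [tensorDiv_apply]
  refine Finset.sum_congr rfl fun b _ => ?_
  rw [partialDeriv_mul_const, mul_comm]

/-- **`div(f c⊗d)_a = c_a (d·∇f)`.** [folklore] -/
theorem tensorDiv_mul_dyad_apply (f : UnitAddTorus (Fin 3) → ℝ) (c d : Fin 3 → ℝ) (x : UnitAddTorus (Fin 3)) (a : Fin 3) :
    tensorDiv (fun y a b => f y * (c a * d b)) x a = c a * ∑ b, d b * Torus.partialDeriv b f x := by
  rw [tensorDiv_mul_const_apply f (fun a b => c a * d b) x a, Finset.mul_sum]
  exact Finset.sum_congr rfl fun b _ => by ring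

/-- **`div(Y(c⊗d + d⊗c))_a = c_a(d·∇Y) + d_a(c·∇Y)`.** [folklore] -/
theorem tensorDiv_mul_symDyad_apply (Y : UnitAddTorus (Fin 3) → ℝ) (c d : Fin 3 → ℝ) (x : UnitAddTorus (Fin 3)) (a : Fin 3) :
    tensorDiv (fun y a b => Y y * (c a * d b + d a * c b)) x a =
      c a * (∑ b, d b * Torus.partialDeriv b Y x) + d a * (∑ b, c b * Torus.partialDeriv b Y x) := by
  rw [tensorDiv_mul_const_apply Y (fun a b => c a * d b + d a * c b) x a, Finset.mul_sum, Finset.mul_sum, ← Finset.sum_add_distrib]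
  exact Finset.sum_congr rfl fun b _ => by ring

/-! ## The integration-by-parts tensor -/

/-- **`ibpTensor σ q c = σ (c⊗∇q + ∇q⊗c - (c·∇q) Id)`** — the symmetric tensor with
`div(ibpTensor) = c σ Δq + (first-order terms)`. [cite: CoiculescuPalasek2025, Lemma 6.4 (proof: integration by parts)] -/
def ibpTensor (σ q : UnitAddTorus (Fin 3) → ℝ) (c : Fin 3 → ℝ) (y : UnitAddTorus (Fin 3)) (a b : Fin 3) : ℝ :=
  σ y * (c a * Torus.partialDeriv b q y + Torus.partialDeriv a q y * c b -
    (∑ l, c l * Torus.partialDeriv l q y) * (if a = b then 1 else 0))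

/-- `ibpTensor` is symmetric. [folklore] -/
theorem ibpTensor_symm (σ q : UnitAddTorus (Fin 3) → ℝ) (c : Fin 3 → ℝ) (y : UnitAddTorus (Fin 3)) (a b : Fin 3) :
    ibpTensor σ q c y a b = ibpTensor σ q c y b a := by
  unfold ibpTensor
  by_cases h : a = b
  · subst h; ring
  · rw [if_neg h, if_neg (Ne.symm h)]; ring

/-- The directional derivative `c·∇q` as a function. [folklore] -/
def dirD (c : Fin 3 → ℝ) (q : UnitAddTorus (Fin 3) → ℝ) (y : UnitAddTorus (Fin 3)) : ℝ := ∑ l, c l * Torus.partialDeriv l q y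

/-- `c·∇q` is smooth. [folklore] -/
theorem isSmooth_dirD (c : Fin 3 → ℝ) (hq : IsSmooth q) : IsSmooth (dirD c q) :=
  Torus.isSmooth_finset_sum Finset.univ fun l _ => contDiff_const.mul (hq.partialDeriv l)

/-- `∂_b (c·∇q) = ∑_l c_l ∂_b∂_l q`. [folklore] -/
theorem partialDeriv_dirD (c : Fin 3 → ℝ) (hq : IsSmooth q) (b : Fin 3) (x : UnitAddTorus (Fin 3)) :
    Torus.partialDeriv b (dirD c q) x = ∑ l, c l * Torus.partialDeriv b (Torus.partialDeriv l q) x := by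
  unfold dirD
  have hl : ∀ l ∈ (Finset.univ : Finset (Fin 3)), IsContDiff 1 fun y => c l * Torus.partialDeriv l q y := by
    intro l _
    have h : IsSmooth fun y => c l * Torus.partialDeriv l q y := contDiff_const.mul (hq.partialDeriv l)
    exact h.isContDiff (by simp)
  rw [partialDeriv_finset_sum Finset.univ hl]
  refine Finset.sum_congr rfl fun l _ => ?_
  rw [partialDeriv_const_mul]

/-- The entries of `ibpTensor` as sums of three smooth products. [folklore] -/
theorem ibpTensor_entry_eq (σ q : UnitAddTorus (Fin 3) → ℝ) (c : Fin 3 → ℝ) (a b : Fin 3) :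
    (fun y => ibpTensor σ q c y a b) =
      (fun y => c a * (σ y * Torus.partialDeriv b q y)) + (fun y => c b * (σ y * Torus.partialDeriv a q y)) -
        (fun y => (if a = b then 1 else 0) * (σ y * dirD c q y)) := by
  funext y
  simp only [Pi.add_apply, Pi.sub_apply, ibpTensor, dirD]
  ring

/-- `ibpTensor` is smooth. [folklore] -/
theorem isSmooth_ibpTensor (hσ : IsSmooth σ) (hq : IsSmooth q) (c : Fin 3 → ℝ) : IsSmooth (ibpTensor σ q c) := by
  refine isSmooth_of_entries fun a b => ?_
  rw [ibpTensor_entry_eq]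
  exact ((contDiff_const.mul (hσ.mul (hq.partialDeriv b))).add (contDiff_const.mul (hσ.mul (hq.partialDeriv a)))).sub
    (contDiff_const.mul (hσ.mul (isSmooth_dirD c hq)))

/-- **The divergence of the integration-by-parts tensor**:
`div(ibpTensor σ q c)_a = c_a (σ Δq + ∇σ·∇q) + ∂_a q (c·∇σ) - ∂_a σ (c·∇q)`.
[cite: CoiculescuPalasek2025, Lemma 6.4 (proof: integration by parts)] -/
theorem tensorDiv_ibpTensor_apply (hσ : IsSmooth σ) (hq : IsSmooth q) (c : Fin 3 → ℝ) (x : UnitAddTorus (Fin 3)) (a : Fin 3) :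
    tensorDiv (ibpTensor σ q c) x a =
      c a * (σ x * Torus.laplacian q x + ∑ b, Torus.partialDeriv b σ x * Torus.partialDeriv b q x) +
        Torus.partialDeriv a q x * dirD c σ x - Torus.partialDeriv a σ x * dirD c q x := by
  have hσ1 : IsContDiff 1 σ := hσ.isContDiff (by simp)
  have hq1 : ∀ l, IsContDiff 1 (Torus.partialDeriv l q) := fun l => (hq.partialDeriv l).isContDiff (by simp)
  have hd1 : IsContDiff 1 (dirD c q) := (isSmooth_dirD c hq).isContDiff (by simp)
  -- the three pieces of `∂_b (entry a b)`
  have hterm : ∀ b, Torus.partialDeriv b (fun y => ibpTensor σ q c y a b) x =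
      c a * (σ x * Torus.partialDeriv b (Torus.partialDeriv b q) x + Torus.partialDeriv b σ x * Torus.partialDeriv b q x) +
      c b * (σ x * Torus.partialDeriv b (Torus.partialDeriv a q) x + Torus.partialDeriv b σ x * Torus.partialDeriv a q x) -
      (if a = b then 1 else 0) * (σ x * Torus.partialDeriv b (dirD c q) x + Torus.partialDeriv b σ x * dirD c q x) := by
    intro b
    have hA' : IsSmooth (fun y => c a * (σ y * Torus.partialDeriv b q y)) := contDiff_const.mul (hσ.mul (hq.partialDeriv b))
    have hB' : IsSmooth (fun y => c b * (σ y * Torus.partialDeriv a q y)) := contDiff_const.mul (hσ.mul (hq.partialDeriv a))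
    have hC' : IsSmooth (fun y => (if a = b then 1 else 0) * (σ y * dirD c q y)) := contDiff_const.mul (hσ.mul (isSmooth_dirD c hq))
    have hA : IsContDiff 1 (fun y => c a * (σ y * Torus.partialDeriv b q y)) := hA'.isContDiff (by simp)
    have hB : IsContDiff 1 (fun y => c b * (σ y * Torus.partialDeriv a q y)) := hB'.isContDiff (by simp)
    have hC : IsContDiff 1 (fun y => (if a = b then 1 else 0) * (σ y * dirD c q y)) := hC'.isContDiff (by simp)
    rw [ibpTensor_entry_eq, partialDeriv_sub (hA.add hB) hC, partialDeriv_add hA hB]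
    simp only [Pi.add_apply, Pi.sub_apply]
    rw [partialDeriv_const_mul, partialDeriv_const_mul, partialDeriv_const_mul, partialDeriv_mul hσ1 (hq1 b), partialDeriv_mul hσ1 (hq1 a),
      partialDeriv_mul hσ1 hd1]
  rw [tensorDiv_apply]
  simp_rw [hterm]
  rw [Finset.sum_sub_distrib, Finset.sum_add_distrib]
  -- the `δ_ab` sum collapses to `b = a`
  have hδ : ∑ b, (if a = b then 1 else 0) * (σ x * Torus.partialDeriv b (dirD c q) x + Torus.partialDeriv b σ x * dirD c q x) =
      σ x * Torus.partialDeriv a (dirD c q) x + Torus.partialDeriv a σ x * dirD c q x := by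
    rw [Finset.sum_eq_single a]
    · simp
    · intro b _ hb; rw [if_neg (Ne.symm hb), zero_mul]
    · intro ha; exact absurd (Finset.mem_univ a) ha
  rw [hδ, partialDeriv_dirD c hq a x]
  -- the Laplacian and the commutation `∂_b∂_a = ∂_a∂_b`
  rw [laplacian_eq_sum_partialDeriv_partialDeriv hq x]
  have hcomm : ∀ b, Torus.partialDeriv b (Torus.partialDeriv a q) x = Torus.partialDeriv a (Torus.partialDeriv b q) x :=
    fun b => partialDeriv_comm hq b a x
  simp_rw [hcomm]
  simp only [dirD, Finset.mul_sum, ← Finset.sum_add_distrib, mul_add, ← Finset.sum_sub_distrib]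
  refine Finset.sum_congr rfl fun b _ => ?_
  ring

/-- **`c_a σ Δq` through the integration-by-parts tensor**:
`c_a σ Δq = div(ibpTensor σ q c)_a - [c_a(∇σ·∇q) + ∂_a q(c·∇σ) - ∂_a σ(c·∇q)]`. [cite: CoiculescuPalasek2025, Lemma 6.4 (proof)] -/
theorem mul_laplacian_eq_tensorDiv_ibpTensor_sub (hσ : IsSmooth σ) (hq : IsSmooth q) (c : Fin 3 → ℝ) (x : UnitAddTorus (Fin 3)) (a : Fin 3) :
    c a * (σ x * Torus.laplacian q x) = tensorDiv (ibpTensor σ q c) x a -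
      (c a * (∑ b, Torus.partialDeriv b σ x * Torus.partialDeriv b q x) + Torus.partialDeriv a q x * dirD c σ x -
        Torus.partialDeriv a σ x * dirD c q x) := by
  rw [tensorDiv_ibpTensor_apply hσ hq c x a]; ring

end CP25

end Literature.Analysis.FluidPDE
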